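import Summits.MatrixMultiplication.OmegaCensus.STPPSmallPatternKernelSearchX2

/-!
# ω-census, `(2,1,1)^6` is infeasible in `ℤ/29` — kernel search, part 44 of 58

HONEST FRAMING (pub-omega census; verbatim): lottery ticket; floor = certified bounds/negative ranges.
Census STRUCTURE bookkeeping of the STPP track (seat pub-omega-eng2 = ENG2, gen 33, on the kernel engine + reflection of seat
pub-omega-stpp-3 gen 23; STRUCTURE row B5, the threshold column `T1(H) = max {k : (2,1,1)^k ⊆ H}`, lower side of the
`k = 6` ORDER LAW `(2,1,1)⁶ ⊆ G ↔ 30 ≤ |G|`), not progress on `ω`: small patterns in small groups bound no exponent.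

Chunks of the kernel mask search `STPP211Neg.search2 (zcode 29) 6` (`decide +kernel`; ≈ 217 s of kernel time predicted);
assembled in `STPPSmallPatternNone211K6Z29.lean`.  Chunk entries `(d, x1, x2)`: representative `d` of `A₀ = {0, d}`, FIRST-level exclusion mask `x1`, SECOND-level exclusion mask `x2` (`STPPSmallPatternKernelSearchX2.lean`).

References: H. Cohn, R. Kleinberg, B. Szegedy, C. Umans, FOCS 2005 (arXiv:math/0511460), Def. 5.1.  Record: pub-omega HOME
`pub-omega-eng2-g33/results/none6/` (ENG2's C mirror `k211c.c` of the kernel tree — validated against stpp-3's Python mirror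
`k211v3.py` on the landed `k = 5` cells to the translation count — gives COMPLETE NONE on this cell with 227842494 mask
translations; per-`(d,c₁,c₂)` cost tables, planner `plan6.py`; farm calibration 46 µs per translation; not used by the proofs).
-/

set_option Elab.async false  -- several kernel pieces: elaborate sequentially (memory)

namespace Summit.MatrixMultiplication.OmegaCensus

namespace STPP211Neg

/-- Chunk list 82 of `ℤ/29`, `k = 6` (1831731 mask translations in the mirror ≈ 84 s predicted). -/
def Z29k6.ch82 : List (ℕ × ℕ × ℕ) :=
  [(1, 536870399, 536772607)]

/-- Kernel search over chunk list 82 of `ℤ/29`, `k = 6`. -/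
theorem Z29k6.s82 : search2 (zcode 29) 6 Z29k6.ch82 = true := by
  decide +kernel

/-- Chunk list 83 of `ℤ/29`, `k = 6` (1872093 mask translations in the mirror ≈ 86 s predicted). -/
def Z29k6.ch83 : List (ℕ × ℕ × ℕ) :=
  [(1, 536870399, 535953407)]

/-- Kernel search over chunk list 83 of `ℤ/29`, `k = 6`. -/
theorem Z29k6.s83 : search2 (zcode 29) 6 Z29k6.ch83 = true := by
  decide +kernel

/-- Chunk list 84 of `ℤ/29`, `k = 6` (1024471 mask translations in the mirror ≈ 47 s predicted). -/
def Z29k6.ch84 : List (ℕ × ℕ × ℕ) :=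
  [(1, 536870399, 1048575), (1, 536869887, 536868864)]

/-- Kernel search over chunk list 84 of `ℤ/29`, `k = 6`. -/
theorem Z29k6.s84 : search2 (zcode 29) 6 Z29k6.ch84 = true := by
  decide +kernel

/-- The chunk lists of this part, concatenated. -/
def Z29k6.part44 : List (ℕ × ℕ × ℕ) :=
  Z29k6.ch82 ++ Z29k6.ch83 ++ Z29k6.ch84

/-- The kernel search over this part's chunks (assembled). -/
theorem Z29k6.ps44 : search2 (zcode 29) 6 Z29k6.part44 = true := by
  simp only [Z29k6.part44, search2_append, Z29k6.s82, Z29k6.s83, Z29k6.s84, Bool.and_self]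

end STPP211Neg

end Summit.MatrixMultiplication.OmegaCensus
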